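import Mathlib.RingTheory.PowerSeries.Substitution
import Mathlib.RingTheory.PowerSeries.Binomial
import Mathlib.NumberTheory.Padics.MahlerBasis
import Literature.NumberTheory.EllipticCurves.PAdicLFunctionK
import Literature.NumberTheory.EllipticCurves.PAdicBSDMemIwasawaRatProofs
import Literature.NumberTheory.EllipticCurves.RankinSelbergLFunctionK
import Literature.NumberTheory.EllipticCurves.HeckeOperators
import Literature.NumberTheory.EllipticCurves.HeegnerPoints
import HarnessLib

/-!
# The two-variable `p`-adic `L`-function of `E/ℚ` over an imaginary quadratic field `K`:
# the receptacle `ℤ_p⟦Gal(K_∞/K) × Γ⟧ ⊗ ℚ_p` and its cyclotomic Taylor coefficients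

Trunk T-NT-EC (Literature/NumberTheory/EllipticCurves); definition request
`defn-twoVariablePAdicLFunctionK` (route BirchSwinnertonDyer, crux `PAdicOrderThesisR2`
stmt-0487, line `lambda-adic-gz-square-class`), to sit next to
`Literature.NumberTheory.EllipticCurves.padicLFunctionEK` (`PAdicLFunctionK.lean`).

**The object of the request.** For `f` the newform of `E/ℚ`, `p` a good ordinary prime, `K` an
imaginary quadratic field (discriminant `D` odd, Heegner hypothesis for `N`, `p` split), `H_s` the
ring class field of conductor `p^s`, `H_∞ = ⋃ H_s`, `Γ = 1 + pℤ_p` with topological generator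
`γ₀`, Hida and Perrin-Riou attach to `f` the two-variable `p`-adic `L`-function
`ℒ_f ∈ 𝒜⟦Gal(H_∞/K) × Γ⟧ ⊗ ℬ` interpolating the special values `L(f, χ̄, 1)` of the Rankin
product of `f` with the theta series of the finite-order characters `χ` of `Gal(H_∞/K) × Γ`
(Howard 2005, §1 and §3; Perrin-Riou 1987, Thm. 1.1; Perrin-Riou 1988; Hida 1985). Expanding in
`γ₀ - 1`,

  `ℒ_f = ℒ_{f,0} + ℒ_{f,1} · (γ₀ - 1) + ℒ_{f,2} · (γ₀ - 1)² + ⋯`,  `ℒ_{f,k} ∈ 𝒜⟦Gal(H_∞/K)⟧ ⊗ ℬ`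

(Howard 2005, §1 (1)); the Heegner hypothesis forces `ℒ_{f,0} = 0` (Howard 2005, Prop. 3.0.4),
and Howard's `Λ`-adic Gross–Zagier theorem (Thm. 2) identifies `κ · log_p(γ₀) · ℒ_{f,1}` with the
Heegner `L`-function `ℒ_Heeg` built from `p`-adic heights of Heegner points; after the natural
projection `e : ℤ_p⟦Gal(H_∞/K)⟧ ⊗ ℚ_p → Λ_anti = ℤ_p⟦Gal(K_∞/K)⟧ ⊗ ℚ_p` to the anticyclotomic
`ℤ_p`-extension `K_∞ ⊂ H_∞` (Howard 2005, §1, p. 5) the route reads off the Taylor coefficients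
`[T^k] e(ℒ_{f,1})` in `T = γ - 1`, `γ` a topological generator of `Gal(K_∞/K)`; it needs
`c(K) := [T²] e(ℒ_{f,1})`.

**Part 1 of the request: the receptacle and its coordinates (fully constructed).** After the
choice of the two topological generators — `γ₀ := cyclotomicGenerator p = 1 + p` for `Γ` (the
variable `S = γ₀ - 1` of the tree's one-variable `padicLFunction`, Mazur–Tate–Teitelbaum) and
`γ` for `Gal(K_∞/K)` (tree: `ZpExtension.IsTopGenerator`, as in `LambdaAdicSelmerData`) — the
completed group ring `ℤ_p⟦Gal(K_∞/K) × Γ⟧ ⊗ ℚ_p` of the `ℤ_p²`-extension `K_∞ ℚ_∞ / K` is the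
ring of bounded power series in `ℚ_p⟦T⟧⟦S⟧` (Mazur–Tate–Teitelbaum 1986, §I.12 for one
variable; the tree's `MemIwasawaRat`). We define

* `CycAntiSeries p := PowerSeries (PowerSeries ℚ_[p])` — outer variable `S = γ₀ - 1`
  (cyclotomic), inner variable `T = γ - 1` (anticyclotomic); `IsBoundedCycAnti` — membership in
  `ℤ_p⟦T, S⟧ ⊗ ℚ_p`; `HasValueAt L x y v` — `L(S = x, T = y) = v` in `ℂ_p` (`|x|, |y| < 1`), the
  shape in which values at finite-order characters `(ψ, η)`, `x = ψ(γ₀) - 1`, `y = η(γ) - 1`, are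
  prescribed by an interpolation property;
* `cycTaylorCoeff k L = ℒ_k` (Howard's expansion (1)), `cycLinearTerm L = ℒ_1`,
  `antiRestrict L = ℒ_0` (restriction to the anticyclotomic line `ψ = 𝟙`),
  `cycRestrict L = L(S, T = 0)` (restriction to the cyclotomic line `η = 𝟙`, where the
  comparison with `padicLFunctionEK = L_p(E,S) · L_p(E^{(D)},S)` takes place, Perrin-Riou 1987,
  (1.1)), `linearTermCoeff k L = [T^k] ℒ_1` (so `c(K) = linearTermCoeff 2 (e ℒ_f)`);
* the change of topological generator `γ ↦ γ^u`, `u ∈ ℤ_p^×`, on `Λ_anti ⊗ ℚ_p = ℚ_p⟦T⟧`: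
  `antiReparam u G = G((1+T)^u - 1)` (`reparamSeries u = (1+T)^u - 1`, Mathlib
  `PowerSeries.binomialSeries` over the binomial ring `ℤ_[p]`), with the involution
  `antiInvolution = antiReparam (-1)` (`T ↦ (1+T)⁻¹ - 1`, inversion on group-like elements,
  Howard's `λ ↦ λ^ι`);
* PROVED API: unfolding/compatibility lemmas, `IsBoundedCycAnti.memIwasawaRat_cycTaylorCoeff`
  (each `ℒ_k ∈ Λ_anti ⊗ ℚ_p`), and the **generator-independence of the square class of the
  leading coefficient**: if `[T⁰]G = [T¹]G = 0` then `[T²](antiReparam u G) = u² · [T²]G`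
  (`coeff_two_antiReparam`), so that `c(K) ≠ 0` and the class of `c(K)` in `ℚ_p^×/(ℚ_p^×)²` do not
  depend on the choice of `γ` as soon as `ord_T e(ℒ_{f,1}) ≥ 2` — the situation of the route.

**Part 2 of the request: the function itself, by its interpolation property.** With the
vocabulary of `RankinSelbergLFunctionK.lean` (finite-order characters `𝒲 = η · (ψ ∘ χ_cyc)` of the
`ℤ_p²`-extension as continuous characters of `Γ_K`, their values on ideals "extended by zero",
conductor, root number `τ(𝒲)`, and the twisted `L`-function `L(f ⊗ K, 𝒲, s)` — all reusing the
tree's Artin-representation machinery) we state Nekovář's interpolation formula (Math. Ann. 302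
(1995), (0.5) p. 611, `r = 1`, `𝒞 = 1`; for weight two this is Perrin-Riou 1988 = Perrin-Riou
1987, Thm. 1.1) as the predicate `IsTwoVariablePAdicLFunctionK ι W κ f F` — `F` bounded, and at
every finite-order `𝒲` the value of `F` at `(ψ(γ₀) - 1, η(γ) - 1)` is `i_p` of the printed
right-hand side (`nekovarAlgebraicPart`, transported by the embedding datum
`ι : ℚ̄ ⊂ ℂ → ℂ_p`, times `nekovarPadicFactor`, the factors containing the unit root) — and DEFINE

  `twoVariablePAdicLFunctionK ι W κ hf := the unique such F` (junk `0` otherwise),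

the pattern of `unitRoot` / `existsUnique_isSplitMultPAdicLFunctionOf`; existence (Hida,
Perrin-Riou; Nekovář 5.10 "is an Iwasawa function") and uniqueness (Weierstrass preparation, tree
`MemIwasawaRat.eq_zero_of_forall_hasSum_zero`) form the named fact
`existsUnique_isTwoVariablePAdicLFunctionK`, the only statement asserted-as-cited in this file.
The consumer's `c(K)` is `linearTermCoeff 2 (twoVariablePAdicLFunctionK …)`.

**Normalisations and what is NOT claimed.** This is Perrin-Riou's/Nekovář's `L_p(f ⊗ K, 𝟙)` on
the `ℤ_p²`-extension, i.e. the image under `e` of Howard's `ℒ_f` *up to the normalisation of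
Howard 2005, §3* (`L_f = (1 - p/α²)(1 - 1/α²) l_f`, the factor `(1 - Cε(C)ψ(C)⁻²)⁻¹`, and
Howard's remark that Perrin-Riou's `ψ(C)` is his `ψ(C)²`); the comparison constant is NOT
asserted here, so Howard's Thm. 2 must be vendored against Howard's own normalisation or with
that constant made explicit. Howard's description of the linear term through the `p`-adic modular
forms `G_σ` (`a_m(G_{σκ}) = -∑_{(n,p)=1} r_𝔞(m|D| - nN) σ'_𝔞(n)`, Prop. 3.0.4–3.0.5,
Cor. 3.0.7) is not formalised (it needs Hida's ordinary linear functional on `p`-adic modular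
forms, absent from the tree).

## References

* B. Howard, *The Iwasawa theoretic Gross–Zagier theorem*, Compositio Math. 141 (2005), 811–846
  (held: `paper:arxiv-1202.6349`): §1 (the expansion (1), `ℒ_{f,0} = 0`, Thm. 1, Thm. 2, the
  projection `e`), §3 (Lemma 3.0.2, Prop. 3.0.4, Prop. 3.0.5, Cor. 3.0.7).
* B. Perrin-Riou, *Points de Heegner et dérivées de fonctions `L` `p`-adiques*, Invent. Math. 89
  (1987), 455–510, Thm. 1.1 and (1.1) [cite key `PerrinRiou1987`].
* B. Perrin-Riou, *Fonctions `L` `p`-adiques associées à une forme modulaire et à un corps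
  quadratique imaginaire*, J. London Math. Soc. (2) 38 (1988), 1–32 [cite key `PerrinRiou1988`].
* J. Nekovář, *On the `p`-adic height of Heegner cycles*, Math. Ann. 302 (1995), 609–686 (held:
  `paper:doi-10-1007-bf01444511`; page images of pp. 609–612 read): (0.2) standing assumptions,
  (0.5) p. 611 (the interpolation formula), p. 612 (`α_p(f)`, `τ`, `⟨f,f⟩_N`, `𝒲̄ = 𝒲⁻¹`),
  Thm. 5.10 and (6.1) [cite key `Nekovar1995`].
* H. Hida, *A `p`-adic measure attached to the zeta functions associated with two elliptic
  modular forms I*, Invent. Math. 79 (1985), 159–195.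
* B. Mazur, J. Tate, J. Teitelbaum, Invent. Math. 84 (1986), §I.12–I.13 (`Λ ⊗ ℚ` as bounded
  power series; change of generator).
-/

noncomputable section

open PowerSeries

namespace Literature.NumberTheory.EllipticCurves

/-! ### The receptacle `ℚ_p⟦T⟧⟦S⟧` and its named coordinates -/

section Receptacle

variable (p : ℕ) [Fact p.Prime]

/-- **The receptacle of the two-variable `p`-adic `L`-function**: `ℚ_p⟦T⟧⟦S⟧`, power series in the
cyclotomic variable `S` (outer; `S ↔ γ₀ - 1`, `γ₀ = cyclotomicGenerator p = 1 + p`, the variable of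
`padicLFunction`) with coefficients power series in the anticyclotomic variable `T` (inner;
`T ↔ γ - 1` for a topological generator `γ` of `Gal(K_∞/K) ≅ ℤ_p`). Its bounded elements
(`IsBoundedCycAnti`) form `ℤ_p⟦T, S⟧ ⊗ ℚ_p ≅ ℤ_p⟦Gal(K_∞/K) × Γ⟧ ⊗ ℚ_p`, the home of the image
`e(ℒ_f)` of Howard's `ℒ_f ∈ 𝒜⟦Gal(H_∞/K) × Γ⟧ ⊗ ℬ` on the `ℤ_p²`-extension of `K`
(Howard 2005, §1; Perrin-Riou 1987, Thm. 1.1: "a two-variable Iwasawa function"; one variable: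
Mazur–Tate–Teitelbaum 1986, §I.12). [cite: MazurTateTeitelbaum1986Invent, §I.12–I.13] -/
abbrev CycAntiSeries : Type := PowerSeries (PowerSeries ℚ_[p])

variable {p}

/-- The `k`-th **cyclotomic Taylor coefficient** `ℒ_k ∈ ℚ_p⟦T⟧` of `ℒ = ∑_k ℒ_k S^k`,
`S = γ₀ - 1` (Howard 2005, §1, (1): `ℒ_f = ℒ_{f,0} + ℒ_{f,1}·(γ₀ - 1) + …`).
[cite: Howard2005, §1 eq. (1)] -/
abbrev cycTaylorCoeff (k : ℕ) (L : CycAntiSeries p) : PowerSeries ℚ_[p] :=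
  PowerSeries.coeff k L

/-- The **linear term** `ℒ_1` of the cyclotomic expansion — the object of Howard's `Λ`-adic
Gross–Zagier theorem (Howard 2005, §1 (1) and Thm. 2). [cite: Howard2005, §1 eq. (1)] -/
abbrev cycLinearTerm (L : CycAntiSeries p) : PowerSeries ℚ_[p] :=
  cycTaylorCoeff 1 L

/-- **Restriction to the anticyclotomic line** `ψ = 𝟙` (`S = 0`): `ℒ ↦ ℒ_0 = ℒ(·, 𝟙)`; for Howard's
`ℒ_f` this vanishes by the Heegner hypothesis (Howard 2005, Prop. 3.0.4: "`ℒ_f(η, 𝟙) = 0` for all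
continuous characters `η` … equivalent to `ℒ_{f,0} = 0`"). [cite: Howard2005, Prop. 3.0.4] -/
abbrev antiRestrict (L : CycAntiSeries p) : PowerSeries ℚ_[p] :=
  PowerSeries.constantCoeff L

/-- **Restriction to the cyclotomic line** `η = 𝟙` (`T = 0`): `∑_k ℒ_k S^k ↦ ∑_k ℒ_k(0) S^k ∈ ℚ_p⟦S⟧`.
For the two-variable `p`-adic `L`-function this is the cyclotomic `p`-adic `L`-function of `f`
over `K`, which factors as `L_p(f) · L_p(f^{(ε)})` times a non-vanishing factor (Perrin-Riou 1987,
(1.1); tree: `padicLFunctionEK`). [cite: PerrinRiou1987, §1.1 (1.1)] -/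
def cycRestrict (L : CycAntiSeries p) : PowerSeries ℚ_[p] :=
  PowerSeries.map PowerSeries.constantCoeff L

/-- `[T^k] ℒ_1 ∈ ℚ_p`, the `k`-th anticyclotomic Taylor coefficient of the linear term; the route
`lambda-adic-gz-square-class` uses `c(K) := [T²] e(ℒ_{f,1})` (Howard 2005, §1, the ideal
`e(ℒ_{f,1}) Λ_anti`). [cite: Howard2005, §1 (e(ℒ_{f,1})Λ_anti)] -/
abbrev linearTermCoeff (k : ℕ) (L : CycAntiSeries p) : ℚ_[p] :=
  PowerSeries.coeff k (cycLinearTerm L)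

/-- **Boundedness**: all coefficients `[T^k S^j] L` are bounded in `ℚ_p`, i.e.
`L ∈ ℤ_p⟦T, S⟧ ⊗ ℚ_p = ℤ_p⟦Gal(K_∞/K) × Γ⟧ ⊗ ℚ_p` (some `p^n L` has coefficients in `ℤ_p`); the
two-variable analogue of the tree's `MemIwasawaRat` (Mazur–Tate–Teitelbaum 1986, §I.12:
`Λ ⊗ ℚ =` bounded power series). [cite: MazurTateTeitelbaum1986Invent, §I.12] -/
def IsBoundedCycAnti (L : CycAntiSeries p) : Prop :=
  ∃ C : ℝ, ∀ j k : ℕ, ‖PowerSeries.coeff k (PowerSeries.coeff j L)‖ ≤ C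

/-- **Value of `L` at a point `(x, y)` of the open unit bidisc of `ℂ_p`**: `HasValueAt L x y v` says
`∑_{j,k} [T^k S^j]L · x^j y^k = v` (a summable family in `ℂ_p`; for bounded `L` and `|x|, |y| < 1`
the family is summable). Values at finite-order characters `(ψ, η)` of `Γ × Gal(K_∞/K)` are the
values at `x = ψ(γ₀) - 1`, `y = η(γ) - 1` (`γ₀ = cyclotomicGenerator p`), as in the tree's
one-variable `IsPAdicLFunctionOf` (Mazur–Tate–Teitelbaum 1986, §I.13).
[cite: MazurTateTeitelbaum1986Invent, §I.13] -/
def HasValueAt (L : CycAntiSeries p) (x y v : ℂ_[p]) : Prop :=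
  HasSum (fun jk : ℕ × ℕ ↦
    algebraMap ℚ_[p] ℂ_[p] (PowerSeries.coeff jk.2 (PowerSeries.coeff jk.1 L)) *
      x ^ jk.1 * y ^ jk.2) v

/-! #### API -/

/-- `ℒ_0` is the `0`-th cyclotomic Taylor coefficient. [folklore] -/
theorem antiRestrict_eq_cycTaylorCoeff_zero (L : CycAntiSeries p) :
    antiRestrict L = cycTaylorCoeff 0 L :=
  (PowerSeries.coeff_zero_eq_constantCoeff_apply L).symm

/-- `[S^k]` of the cyclotomic restriction is `ℒ_k(T = 0)`. [folklore] -/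
@[simp] theorem coeff_cycRestrict (k : ℕ) (L : CycAntiSeries p) :
    PowerSeries.coeff k (cycRestrict L) = PowerSeries.constantCoeff (cycTaylorCoeff k L) :=
  PowerSeries.coeff_map _ _ _

/-- The two restrictions agree at the origin: `cycRestrict L (0) = antiRestrict L (0) = [T⁰S⁰]L`.
[folklore] -/
theorem constantCoeff_cycRestrict (L : CycAntiSeries p) :
    PowerSeries.constantCoeff (cycRestrict L) = PowerSeries.constantCoeff (antiRestrict L) := by
  rw [← PowerSeries.coeff_zero_eq_constantCoeff_apply, coeff_cycRestrict,
    antiRestrict_eq_cycTaylorCoeff_zero]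

/-- The linear coefficient of the cyclotomic restriction is `ℒ_1(0) = [T⁰] ℒ_1`. [folklore] -/
theorem coeff_one_cycRestrict (L : CycAntiSeries p) :
    PowerSeries.coeff 1 (cycRestrict L) = linearTermCoeff 0 (L := L) := by
  rw [coeff_cycRestrict, linearTermCoeff, PowerSeries.coeff_zero_eq_constantCoeff_apply]

/-- `cycRestrict` is a ring homomorphism (it is `PowerSeries.map` of `constantCoeff`). [folklore] -/
theorem cycRestrict_mul (L L' : CycAntiSeries p) :
    cycRestrict (L * L') = cycRestrict L * cycRestrict L' :=
  map_mul _ _ _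

/-- If `ℒ_0 = 0` then the cyclotomic restriction has zero constant term. [folklore] -/
theorem constantCoeff_cycRestrict_eq_zero {L : CycAntiSeries p} (h : antiRestrict L = 0) :
    PowerSeries.constantCoeff (cycRestrict L) = 0 := by
  rw [constantCoeff_cycRestrict, h, map_zero]

/-- A bounded two-variable series has every cyclotomic Taylor coefficient in `Λ_anti ⊗ ℚ_p`
(tree `MemIwasawaRat`: some `p^n ℒ_k ∈ ℤ_p⟦T⟧`). [cite: MazurTateTeitelbaum1986Invent, §I.12] -/
theorem IsBoundedCycAnti.memIwasawaRat_cycTaylorCoeff {L : CycAntiSeries p}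
    (h : IsBoundedCycAnti L) (k : ℕ) : MemIwasawaRat p (cycTaylorCoeff k L) := by
  obtain ⟨C, hC⟩ := h
  exact memIwasawaRat_of_forall_norm_coeff_le fun j ↦ hC k j

/-- A bounded two-variable series has bounded cyclotomic restriction (`∈ Λ ⊗ ℚ_p`). [folklore] -/
theorem IsBoundedCycAnti.memIwasawaRat_cycRestrict {L : CycAntiSeries p}
    (h : IsBoundedCycAnti L) : MemIwasawaRat p (cycRestrict L) := by
  obtain ⟨C, hC⟩ := h
  refine memIwasawaRat_of_forall_norm_coeff_le (C := C) fun j ↦ ?_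
  rw [coeff_cycRestrict, ← PowerSeries.coeff_zero_eq_constantCoeff_apply]
  exact hC j 0

end Receptacle

/-! ### Change of topological generator on `Λ_anti ⊗ ℚ_p = ℚ_p⟦T⟧` and the involution -/

section Reparam

variable {p : ℕ} [Fact p.Prime]

/-- `(1 + T)^u - 1 ∈ ℚ_p⟦T⟧` for `u ∈ ℤ_p` (binomial series over the binomial ring `ℤ_p`, Mathlib
`PowerSeries.binomialSeries`, `PadicInt.instBinomialRing`): the image of `T = γ - 1` under the
change of topological generator `γ ↦ γ^u` of `ℤ_p⟦Gal(K_∞/K)⟧ ≅ ℤ_p⟦T⟧`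
(Mazur–Tate–Teitelbaum 1986, §I.13; Washington §7.2). [cite: MazurTateTeitelbaum1986Invent, §I.13] -/
def reparamSeries (u : ℤ_[p]) : PowerSeries ℚ_[p] :=
  PowerSeries.binomialSeries ℚ_[p] u - 1

/-- `(1+T)^u - 1` has zero constant term. [folklore] -/
@[simp] theorem constantCoeff_reparamSeries (u : ℤ_[p]) :
    PowerSeries.constantCoeff (reparamSeries u) = 0 := by
  simp [reparamSeries]

/-- `[T¹]((1+T)^u - 1) = u`. [folklore] -/
@[simp] theorem coeff_one_reparamSeries (u : ℤ_[p]) :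
    PowerSeries.coeff 1 (reparamSeries u) = (u : ℚ_[p]) := by
  simp [reparamSeries, Algebra.smul_def]

/-- `(1+T)^u - 1` may be substituted into power series. [folklore] -/
theorem hasSubst_reparamSeries (u : ℤ_[p]) : PowerSeries.HasSubst (reparamSeries u) :=
  PowerSeries.HasSubst.of_constantCoeff_zero' (constantCoeff_reparamSeries u)

/-- **Change of topological generator** on `Λ_anti ⊗ ℚ_p = ℚ_p⟦T⟧`: `G(T) ↦ G((1+T)^u - 1)`. If
`γ' = γ^u` (`u ∈ ℤ_p^×`) is another topological generator, an element of `ℤ_p⟦Gal(K_∞/K)⟧ ⊗ ℚ_p`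
written `G'` in `T' = γ' - 1` is written `antiReparam u G'` in `T = γ - 1`
(Mazur–Tate–Teitelbaum 1986, §I.13). [cite: MazurTateTeitelbaum1986Invent, §I.13] -/
def antiReparam (u : ℤ_[p]) (G : PowerSeries ℚ_[p]) : PowerSeries ℚ_[p] :=
  G.subst (reparamSeries u)

/-- **The involution `ι` of `Λ_anti ⊗ ℚ_p`**, "inversion on group-like elements" (Howard 2005, §1:
`λ ↦ λ^ι`): `γ ↦ γ⁻¹`, i.e. `T ↦ (1+T)⁻¹ - 1`, the change of generator by `u = -1`.
[cite: Howard2005, §1 (the involution ι)] -/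
def antiInvolution (G : PowerSeries ℚ_[p]) : PowerSeries ℚ_[p] :=
  antiReparam (-1) G

/-- `antiReparam u` is additive. [folklore] -/
theorem antiReparam_add (u : ℤ_[p]) (G G' : PowerSeries ℚ_[p]) :
    antiReparam u (G + G') = antiReparam u G + antiReparam u G' :=
  PowerSeries.subst_add (hasSubst_reparamSeries u) _ _

/-- `antiReparam u` is multiplicative. [folklore] -/
theorem antiReparam_mul (u : ℤ_[p]) (G G' : PowerSeries ℚ_[p]) :
    antiReparam u (G * G') = antiReparam u G * antiReparam u G' :=
  PowerSeries.subst_mul (hasSubst_reparamSeries u) _ _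

/-- `antiReparam u` is `ℚ_p`-linear. [folklore] -/
theorem antiReparam_smul (u : ℤ_[p]) (c : ℚ_[p]) (G : PowerSeries ℚ_[p]) :
    antiReparam u (c • G) = c • antiReparam u G :=
  PowerSeries.subst_smul (hasSubst_reparamSeries u) _ _

/-- `antiReparam u T = (1+T)^u - 1`. [folklore] -/
@[simp] theorem antiReparam_X (u : ℤ_[p]) :
    antiReparam u (PowerSeries.X : PowerSeries ℚ_[p]) = reparamSeries u :=
  PowerSeries.subst_X (hasSubst_reparamSeries u)

/-- Constants are fixed: `antiReparam u (C c) = C c`. [folklore] -/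
@[simp] theorem antiReparam_C (u : ℤ_[p]) (c : ℚ_[p]) :
    antiReparam u (PowerSeries.C c) = PowerSeries.C c := by
  rw [antiReparam, PowerSeries.subst_C]
  rfl

/-- The constant term is unchanged by a change of generator (it is the value at the trivial
character). [folklore] -/
@[simp] theorem constantCoeff_antiReparam (u : ℤ_[p]) (G : PowerSeries ℚ_[p]) :
    PowerSeries.constantCoeff (antiReparam u G) = PowerSeries.constantCoeff G := by
  rw [antiReparam, ← PowerSeries.coeff_zero_eq_constantCoeff_apply,
    PowerSeries.coeff_subst' (hasSubst_reparamSeries u), finsum_eq_single _ 0]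
  · simp
  · intro d hd
    rw [PowerSeries.coeff_zero_eq_constantCoeff_apply, map_pow, constantCoeff_reparamSeries,
      zero_pow hd, smul_zero]

/-- **Generator-independence of the square class of the leading coefficient.** If `G ∈ ℚ_p⟦T⟧`
has `[T⁰]G = [T¹]G = 0` (order `≥ 2` at the augmentation ideal), then after the change of
generator `γ ↦ γ^u` its `T²`-coefficient is multiplied by `u²`:
`[T²] G((1+T)^u - 1) = u² · [T²] G`. Hence for `u ∈ ℤ_p^×` neither the vanishing of `[T²]G` nor
its class in `ℚ_p^× / (ℚ_p^×)²` depends on the choice of topological generator — the invariance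
used by the route for `c(K) = [T²] e(ℒ_{f,1})` (where `ord_T ≥ 2`). Elementary.
[folklore] -/
theorem coeff_two_antiReparam (u : ℤ_[p]) {G : PowerSeries ℚ_[p]}
    (h0 : PowerSeries.constantCoeff G = 0) (h1 : PowerSeries.coeff 1 G = 0) :
    PowerSeries.coeff 2 (antiReparam u G) = (u : ℚ_[p]) ^ 2 * PowerSeries.coeff 2 G := by
  -- write `G = X² · H` and `(1+T)^u - 1 = X · b`
  obtain ⟨H, hH⟩ : PowerSeries.X ^ 2 ∣ G := by
    rw [PowerSeries.X_pow_dvd_iff]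
    intro m hm
    interval_cases m
    · rwa [PowerSeries.coeff_zero_eq_constantCoeff]
    · exact h1
  obtain ⟨b, hb⟩ : PowerSeries.X ∣ reparamSeries u := by
    rw [PowerSeries.X_dvd_iff]
    exact constantCoeff_reparamSeries u
  have hs := hasSubst_reparamSeries u
  -- `[T¹]((1+T)^u - 1) = u` is the constant term of `b`
  have hu : (u : ℚ_[p]) = PowerSeries.constantCoeff b := by
    rw [← coeff_one_reparamSeries u, hb, ← PowerSeries.coeff_zero_eq_constantCoeff_apply]
    exact PowerSeries.coeff_succ_X_mul 0 b
  -- `[T²] G = H(0)` and `H((1+T)^u - 1)(0) = H(0)`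
  have h2 : PowerSeries.coeff 2 G = PowerSeries.constantCoeff H := by
    rw [hH, PowerSeries.coeff_X_pow_mul', if_pos le_rfl, Nat.sub_self,
      PowerSeries.coeff_zero_eq_constantCoeff_apply]
  have hc : PowerSeries.constantCoeff (H.subst (reparamSeries u)) = PowerSeries.constantCoeff H :=
    constantCoeff_antiReparam u H
  set K := H.subst (reparamSeries u) with hK
  rw [h2, antiReparam, hH, PowerSeries.subst_mul hs, PowerSeries.subst_pow hs,
    PowerSeries.subst_X hs, ← hK, hb,
    show (PowerSeries.X * b) ^ 2 * K = PowerSeries.X ^ 2 * (b ^ 2 * K) by ring,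
    PowerSeries.coeff_X_pow_mul', if_pos le_rfl, Nat.sub_self,
    PowerSeries.coeff_zero_eq_constantCoeff_apply, map_mul, map_pow, hc, ← hu]

/-- The involution fixes constants and the constant term. [folklore] -/
@[simp] theorem constantCoeff_antiInvolution (G : PowerSeries ℚ_[p]) :
    PowerSeries.constantCoeff (antiInvolution G) = PowerSeries.constantCoeff G :=
  constantCoeff_antiReparam (-1) G

/-- Under the involution the `T²`-coefficient of a series of order `≥ 2` is unchanged
(`u = -1`, `u² = 1`): `[T²] G^ι = [T²] G`. [folklore] -/
theorem coeff_two_antiInvolution {G : PowerSeries ℚ_[p]}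
    (h0 : PowerSeries.constantCoeff G = 0) (h1 : PowerSeries.coeff 1 G = 0) :
    PowerSeries.coeff 2 (antiInvolution G) = PowerSeries.coeff 2 G := by
  rw [antiInvolution, coeff_two_antiReparam (-1) h0 h1]
  simp

end Reparam

/-! ### The interpolation property (Nekovář 1995, (0.5)) and the definition of `e(ℒ_f)` -/

section Interpolation

open scoped MatrixGroups ModularForm
open CongruenceSubgroup NumberField IsDedekindDomain Field
open Literature.NumberTheory.GaloisRepresentations Literature.NumberTheory.EllipticCurves.ModularForms

universe u

variable {p : ℕ} [Fact p.Prime]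

open scoped Classical in
/-- **Transport of complex algebraic numbers to `ℂ_p`** along a fixed ring homomorphism
`ι : ℚ̄ → ℂ_p` on the algebraic numbers of `ℂ` (Mathlib `integralClosure ℚ ℂ`): `ι(z)` if `z` is
algebraic, junk `0` otherwise. Nekovář 1995, (0.2): "Fix an embedding `ℚ̄ ↪ ℂ` … We fix an
embedding `i_p : ℚ̄ ↪ ℚ̄_p`"; Howard 2005, §1: "Fix forever … embeddings `ℚ^alg ↪ ℚ_p^alg` and
`ℚ^alg ↪ ℂ`" — here the composite `i_p ∘ (ℚ̄ ↪ ℂ)⁻¹`. [cite: Nekovar1995, (0.2) p. 610] -/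
def algToPadic (ι : integralClosure ℚ ℂ →+* ℂ_[p]) (z : ℂ) : ℂ_[p] :=
  if h : z ∈ integralClosure ℚ ℂ then ι ⟨z, h⟩ else 0

/-- On algebraic numbers `algToPadic ι` is `ι`. [folklore] -/
theorem algToPadic_of_mem (ι : integralClosure ℚ ℂ →+* ℂ_[p]) {z : ℂ}
    (h : z ∈ integralClosure ℚ ℂ) : algToPadic ι z = ι ⟨z, h⟩ := by
  rw [algToPadic, dif_pos h]

/-- `algToPadic ι 1 = 1`. [folklore] -/
@[simp] theorem algToPadic_one (ι : integralClosure ℚ ℂ →+* ℂ_[p]) : algToPadic ι 1 = 1 := by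
  rw [algToPadic_of_mem ι (Subalgebra.one_mem _)]
  exact map_one ι

/-- `algToPadic ι` is multiplicative on algebraic numbers. [folklore] -/
theorem algToPadic_mul (ι : integralClosure ℚ ℂ →+* ℂ_[p]) {z w : ℂ}
    (hz : z ∈ integralClosure ℚ ℂ) (hw : w ∈ integralClosure ℚ ℂ) :
    algToPadic ι (z * w) = algToPadic ι z * algToPadic ι w := by
  rw [algToPadic_of_mem ι hz, algToPadic_of_mem ι hw, algToPadic_of_mem ι (Subalgebra.mul_mem _ hz hw),
    ← map_mul]
  rfl

variable (K : Type u) [Field K] [NumberField K]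

open scoped Classical in
/-- **The principal ideal `(√D)` of `𝒪_K`** (`D = d_K = NumberField.discr K`; for an imaginary
quadratic field `K = ℚ(√D)` one has `√D ∈ 𝒪_K`, and the ideal does not depend on the sign of the
square root); junk `⊥` if `d_K` is not a square in `𝒪_K`. It enters (0.5) through `𝒲̄((√D))`.
[cite: Nekovar1995, (0.5) p. 611] -/
def sqrtDiscrIdeal : Ideal (𝓞 K) :=
  if h : ∃ d : 𝓞 K, d ^ 2 = (NumberField.discr K : 𝓞 K) then Ideal.span {h.choose} else ⊥

variable {K} {N : ℕ} [NeZero N]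

/-- **Nekovář's interpolation value, complex (algebraic) part.** For `f ∈ S_2(Γ₀(N))` and a
finite-order character `𝒲 = χ` of `Γ_K` this is the right-hand side of Nekovář 1995, (0.5)
(p. 611, with `r = 1`, `𝒞 = 1`) divided by the factors `V_p(f, 𝒲) / α_{N(𝔣)}(f)` that contain the
unit root (kept on the `p`-adic side, `nekovarPadicFactor`):

  `τ(𝒲) · 𝒲(N) · 𝒲̄((√D)) · |D|^{1/2} N(𝔣)^{1/2} · 2 · L(f ⊗ K, 𝒲̄, 1) / ((4π)² ⟨f, f⟩_N)`,

where `𝒲̄ = 𝒲⁻¹`, `𝔣` is the conductor of `𝒲` (`charConductorNat`), `τ(𝒲)` the root number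
(`artinRootNumber`), `𝒲(N)`, `𝒲̄((√D))` the values on the ideals `(N)`, `(√D)` (`heckeIdealValue`),
`L(f ⊗ K, 𝒲̄, 1)` the value of the continued Euler product (`rankinSelbergValue`), and
`⟨f, f⟩_N = ∫_{Γ₀(N)\ℍ} |f|² dx dy` (Nekovář p. 612, `r = 1`) is the tree's
`peterssonProduct (Gamma0 N) 2 f f` (integrand `|f|² y²` against `dx dy / y²` on a fundamental
domain of `Γ₀(N) ∋ -1`, no volume normalisation). Printed (0.5): "`L_p(f ⊗ K, 𝒞)(𝒲) =
τ(𝒞𝒲) 𝒲(N) \overline{𝒞𝒲}((√D)) V_p(f, 𝒞𝒲) · |D|^{1/2} N(𝔣)^{r-1/2} / α_{N(𝔣)}(f) ×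
2((r-1)!)² / (4π)^{2r} · L(f ⊗ K, \overline{𝒞𝒲}, r) / ⟨f, f⟩_N`". By Shimura's algebraicity
theorem this number is algebraic. [cite: Nekovar1995, (0.5) p. 611] -/
def nekovarAlgebraicPart (f : CuspForm (Gamma0 N) 2) (χ : absoluteGaloisGroup K →ₜ* ℂˣ) : ℂ :=
  artinRootNumber χ * heckeIdealValue χ (Ideal.span {(N : 𝓞 K)}) *
    heckeIdealValue χ⁻¹ (sqrtDiscrIdeal K) *
    (Real.sqrt (|(NumberField.discr K : ℝ)| * (charConductorNat χ : ℝ)) : ℂ) *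
    (2 * rankinSelbergValue f χ⁻¹ 1 / ((4 * Real.pi) ^ 2 * peterssonProduct (Gamma0 N) 2 f f))

/-- **Nekovář's interpolation value, `p`-adic part** `V_p(f, 𝒲) · α_p(f)^{-k}` (`N(𝔣) = p^k`):
printed (0.5), p. 611–612: "`V_p(f, 𝒞𝒲) = ∏_{𝔭 ∣ p} (1 - \overline{𝒞𝒲}(𝔭) p^{r-1}/α_p(f))
(1 - 𝒞𝒲(𝔭) p^{r-1}/α_p(f))`, `α_p(f)` is the unique root of `t² - a_p t + p^{2r-1}` which is a
`p`-adic unit" (under `i_p`) and "`α_{N(λ)} = α_ℓ^k` if `N(λ) = ℓ^k`"; here `r = 1`, `𝒞 = 1`,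
`i_p(α_p(f)) = unitRoot W p` (the conductor `𝔣` of a character of the `ℤ_p²`-extension is
supported above `p`, so `N(𝔣) = p^k`), the character values `𝒲(𝔭) ∈ μ_{p^∞} ∪ {0}` being
transported by `ι`. [cite: Nekovar1995, (0.5) pp. 611–612] -/
def nekovarPadicFactor (ι : integralClosure ℚ ℂ →+* ℂ_[p]) (W : WeierstrassCurve ℚ)
    [W.IsGloballyMinimal] (χ : absoluteGaloisGroup K →ₜ* ℂˣ) : ℂ_[p] :=
  open scoped Classical in
  let u : ℂ_[p] := algebraMap ℚ_[p] ℂ_[p] (unitRoot W p : ℚ_[p])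
  (∏ᶠ v : HeightOneSpectrum (𝓞 K),
      if (p : 𝓞 K) ∈ v.asIdeal then
        (1 - algToPadic ι (heckeValueAt χ⁻¹ v) / u) * (1 - algToPadic ι (heckeValueAt χ v) / u)
      else 1) *
    u⁻¹ ^ (charConductorNat χ).factorization p

/-- **The interpolation property of the two-variable `p`-adic `L`-function of `f` over the
`ℤ_p²`-extension of `K`** (Nekovář 1995, (0.5), p. 611, `r = 1`, `𝒞 = 1`; Perrin-Riou 1988 for
weight two): `F ∈ ℚ_p⟦T⟧⟦S⟧` is bounded (`∈ ℤ_p⟦Gal(K_∞/K) × Γ⟧ ⊗ ℚ_p`: "`L_p(f ⊗ K, 𝒞)` is an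
Iwasawa function", Nekovář 5.10 after [PR 1, Prop. 29]) and for every finite-order character
`𝒲 = η · (ψ ∘ χ_cyc)` of `G(K_∞/K) = Gal(K_∞^{ac}/K) × Gal(K_∞^{cyc}/K)` — `ψ` a Dirichlet
character modulo `p^m` which is a character of `Γ` (even, of `p`-power order), `η =
antiCycCharacter κ n e` — the value of `F` at the point
`(S, T) = (ψ(γ₀) - 1, η(γ) - 1) = (ψ(1+p) - 1, e(1) - 1)` (transported to `ℂ_p` by `ι`;
`γ₀ = cyclotomicGenerator p`, `κ(γ) = 1`) is

  `ι(nekovarAlgebraicPart f 𝒲) · nekovarPadicFactor ι W 𝒲 = i_p(` right-hand side of (0.5) `)`.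

The Weierstrass model `W` enters only through `unitRoot W p`; `f` is meant to be the newform of
`W` (`twoVariablePAdicLFunctionK`). [cite: Nekovar1995, (0.5) p. 611] -/
def IsTwoVariablePAdicLFunctionK (ι : integralClosure ℚ ℂ →+* ℂ_[p]) (W : WeierstrassCurve ℚ)
    [W.IsGloballyMinimal] (κ : ZpExtension K p) (f : CuspForm (Gamma0 N) 2)
    (F : CycAntiSeries p) : Prop :=
  IsBoundedCycAnti F ∧
    ∀ (m n : ℕ) (ψ : DirichletCharacter ℂ (p ^ m)), ψ.Even → (∃ j : ℕ, orderOf ψ = p ^ j) →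
      ∀ e : AddChar (ZMod (p ^ n)) ℂ,
        HasValueAt F (algToPadic ι (ψ (cyclotomicGenerator p : ZMod (p ^ m))) - 1)
          (algToPadic ι (e 1) - 1)
          (algToPadic ι (nekovarAlgebraicPart f (cycAntiCharacter κ ψ e)) *
            nekovarPadicFactor ι W (cycAntiCharacter κ ψ e))

/-- **The two-variable `p`-adic `L`-function `e(ℒ_f)(K) ∈ ℚ_p⟦T⟧⟦S⟧` of `E = W/ℚ` over the
`ℤ_p²`-extension of the imaginary quadratic field `K`** (Hida 1985; Perrin-Riou 1987, Thm. 1.1,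
1988; in the normalisation of Nekovář 1995, (0.5) = `L_p(f ⊗ K, 𝟙)`; Howard 2005, §1 and §3, for
the same function on `Gal(H_∞/K) × Γ` before projection by `e`): THE bounded series with the
interpolation property `IsTwoVariablePAdicLFunctionK` for the newform `f` of `W` (pinned by the
anonymous argument `IsNewformOf W f`, as in `padicLFunctionE`), if there is exactly one, and the
junk value `0` otherwise (pattern of `unitRoot`; existence and uniqueness under the hypotheses of
the sources is the named fact `existsUnique_isTwoVariablePAdicLFunctionK`). Coordinates: `S =
γ₀ - 1` cyclotomic (`γ₀ = 1 + p`), `T = γ - 1` anticyclotomic for the generator `κ(γ) = 1` of the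
anticyclotomic `ℤ_p`-extension `κ` (shared with `LambdaAdicSelmerData`). Its cyclotomic Taylor
coefficients are `cycTaylorCoeff k`, the linear term `cycLinearTerm` is the projection `e(ℒ_{f,1})`
of the object of Howard's Thm. 2 up to the normalisations relating Howard's `ℒ_f` to
Perrin-Riou's/Nekovář's (same construction, Howard 2005 §3; NOT asserted here), and the route's
`c(K)` is `linearTermCoeff 2` of it. Depends on the embedding datum `ι`.
[cite: Nekovar1995, (0.5) p. 611] [cite: PerrinRiou1987, Thm. 1.1] [cite: Howard2005, §1 and §3] -/
def twoVariablePAdicLFunctionK (ι : integralClosure ℚ ℂ →+* ℂ_[p]) (W : WeierstrassCurve ℚ)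
    [W.IsGloballyMinimal] (κ : ZpExtension K p) {f : CuspForm (Gamma0 N) 2}
    (_hf : IsNewformOf W f) : CycAntiSeries p :=
  open scoped Classical in
  if h : ∃! F : CycAntiSeries p, IsTwoVariablePAdicLFunctionK ι W κ f F then h.choose else 0

/-- **Existence and uniqueness of the two-variable `p`-adic `L`-function** (named fact). Let
`E/ℚ` be elliptic with minimal model `W` and newform `f ∈ S_2(Γ₀(N))`, `p` an odd prime with
`p ∤ N` at which `W` is good ordinary, `K` an imaginary quadratic field of odd discriminant in
which every prime dividing `N` splits (Heegner hypothesis) and `p` splits, `κ` the anticyclotomic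
`ℤ_p`-extension of `K`, `ι` an embedding datum. Then there is exactly one `F ∈ ℚ_p⟦T⟧⟦S⟧` with
`IsTwoVariablePAdicLFunctionK ι W κ f F`. EXISTENCE with the interpolation property: Nekovář 1995,
(0.5) p. 611 (standing assumptions (0.2): `D` odd, all `ℓ ∣ N` split, `p ∤ 2N`, `p` split, `f`
ordinary; "`L_p(f ⊗ K, 𝒞)` … is an Iwasawa function", 5.10, after Perrin-Riou 1988 [PR 1,
Prop. 29]; Thm. 5.10 with (6.1) for the formula), originally Perrin-Riou 1988 / Hida 1985 in
weight two. UNIQUENESS: a bounded element of `ℚ_p ⊗ ℤ_p⟦S, T⟧` vanishing at all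
`(ζ' - 1, ζ - 1)`, `ζ', ζ ∈ μ_{p^∞}`, is zero (Weierstrass preparation in each variable,
Mazur–Tate–Teitelbaum 1986 §I.12; tree `MemIwasawaRat.eq_zero_of_forall_hasSum_zero`), and the
finite-order characters of `G(K_∞/K)` exhaust these points. [cite: Nekovar1995, (0.5) p. 611 and Thm. 5.10]
[cite: PerrinRiou1988, Prop. 29] -/
def existsUnique_isTwoVariablePAdicLFunctionK : Prop :=
  ∀ {p : ℕ} [Fact p.Prime] (ι : integralClosure ℚ ℂ →+* ℂ_[p]) (W : WeierstrassCurve ℚ)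
    [W.IsElliptic] [W.IsGloballyMinimal] (K : Type) [Field K] [NumberField K]
    (κ : ZpExtension K p) {N : ℕ} [NeZero N] {f : CuspForm (Gamma0 N) 2} (_ : IsNewformOf W f),
    p ≠ 2 → ¬ p ∣ N → IsImaginaryQuadratic K → Odd (NumberField.discr K) →
    SatisfiesHeegnerHypothesis N K → ((Ideal.span {(p : ℤ)}).primesOver (𝓞 K)).ncard = 2 →
    IsOrdinaryAt W p → κ.IsAnticyclotomic →
    ∃! F : CycAntiSeries p, IsTwoVariablePAdicLFunctionK ι W κ f F

/-! #### API -/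

variable {ι : integralClosure ℚ ℂ →+* ℂ_[p]} {W : WeierstrassCurve ℚ} [W.IsGloballyMinimal]
  {κ : ZpExtension K p} {f : CuspForm (Gamma0 N) 2}

/-- If exactly one series has the interpolation property, `twoVariablePAdicLFunctionK` has it.
[cite: Nekovar1995, (0.5) p. 611] -/
theorem isTwoVariablePAdicLFunctionK_of_existsUnique (hf : IsNewformOf W f)
    (h : ∃! F : CycAntiSeries p, IsTwoVariablePAdicLFunctionK ι W κ f F) :
    IsTwoVariablePAdicLFunctionK ι W κ f (twoVariablePAdicLFunctionK ι W κ hf) := by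
  rw [twoVariablePAdicLFunctionK, dif_pos h]
  exact h.choose_spec.1

/-- If exactly one series has the interpolation property, any series with the property is
`twoVariablePAdicLFunctionK`. [cite: Nekovar1995, (0.5) p. 611] -/
theorem IsTwoVariablePAdicLFunctionK.eq_twoVariablePAdicLFunctionK (hf : IsNewformOf W f)
    (h : ∃! F : CycAntiSeries p, IsTwoVariablePAdicLFunctionK ι W κ f F) {F : CycAntiSeries p}
    (hF : IsTwoVariablePAdicLFunctionK ι W κ f F) : F = twoVariablePAdicLFunctionK ι W κ hf :=
  h.unique hF (isTwoVariablePAdicLFunctionK_of_existsUnique hf h)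

/-- A series with the interpolation property is bounded, so each of its cyclotomic Taylor
coefficients — in particular the linear term `e(ℒ_{f,1})` — lies in `Λ_anti ⊗ ℚ_p`
(`MemIwasawaRat`). [cite: Nekovar1995, Thm. 5.10 (Iwasawa function)] -/
theorem IsTwoVariablePAdicLFunctionK.memIwasawaRat_cycTaylorCoeff {F : CycAntiSeries p}
    (hF : IsTwoVariablePAdicLFunctionK ι W κ f F) (k : ℕ) : MemIwasawaRat p (cycTaylorCoeff k F) :=
  hF.1.memIwasawaRat_cycTaylorCoeff k

/-- Off the uniqueness regime the definition returns the junk value `0`. [folklore] -/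
theorem twoVariablePAdicLFunctionK_of_not_existsUnique (hf : IsNewformOf W f)
    (h : ¬ ∃! F : CycAntiSeries p, IsTwoVariablePAdicLFunctionK ι W κ f F) :
    twoVariablePAdicLFunctionK ι W κ hf = 0 := by
  rw [twoVariablePAdicLFunctionK, dif_neg h]

/-- In every case the cyclotomic Taylor coefficients of `twoVariablePAdicLFunctionK` lie in
`Λ_anti ⊗ ℚ_p` (either by the interpolation property or because the series is `0`). [folklore] -/
theorem memIwasawaRat_cycTaylorCoeff_twoVariablePAdicLFunctionK (hf : IsNewformOf W f) (k : ℕ) :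
    MemIwasawaRat p (cycTaylorCoeff k (twoVariablePAdicLFunctionK ι W κ hf)) := by
  by_cases h : ∃! F : CycAntiSeries p, IsTwoVariablePAdicLFunctionK ι W κ f F
  · exact (isTwoVariablePAdicLFunctionK_of_existsUnique hf h).memIwasawaRat_cycTaylorCoeff k
  · rw [twoVariablePAdicLFunctionK_of_not_existsUnique hf h]
    exact memIwasawaRat_of_forall_norm_coeff_le (C := 0) fun j ↦ by simp

/-! #### Two printed properties of the function, as named facts, and their consequences -/

/-- **The two-variable `p`-adic `L`-function vanishes identically on the anticyclotomic line**
(named fact). Printed: Nekovář 1995, Corollary of Prop. 5.12 (p. 635): "Suppose that `ψ = 1`,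
`(D/N') = 1` and both `𝒞` and `λ` are anticyclotomic (i.e. `𝒞𝒞^τ = λλ^τ = 1`). Then
`L_p(f ⊗ K, 𝒞) = 0`" (as a function of such `λ`; here `ψ` is the Nebentypus of `f`, trivial, and
`(D/N) = 1` follows from the Heegner hypothesis); the same statement for Howard's `ℒ_f` is Howard
2005, Prop. 3.0.4 ("`ℒ_f(η, 𝟙) = 0` for all `η` … equivalent to `ℒ_{f,0} = 0`"). In the
coordinates of this file: under the hypotheses of `existsUnique_isTwoVariablePAdicLFunctionK`, the
restriction `antiRestrict = cycTaylorCoeff 0` (`S = 0`, i.e. `ψ = 𝟙`) of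
`twoVariablePAdicLFunctionK` is `0` (its values at all `T = η(γ) - 1` vanish and it is bounded).
[cite: Nekovar1995, Cor. of Prop. 5.12 (p. 635)] [cite: Howard2005, Prop. 3.0.4] -/
def antiRestrict_twoVariablePAdicLFunctionK_eq_zero : Prop :=
  ∀ {p : ℕ} [Fact p.Prime] (ι : integralClosure ℚ ℂ →+* ℂ_[p]) (W : WeierstrassCurve ℚ)
    [W.IsElliptic] [W.IsGloballyMinimal] (K : Type) [Field K] [NumberField K]
    (κ : ZpExtension K p) {N : ℕ} [NeZero N] {f : CuspForm (Gamma0 N) 2} (hf : IsNewformOf W f),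
    p ≠ 2 → ¬ p ∣ N → IsImaginaryQuadratic K → Odd (NumberField.discr K) →
    SatisfiesHeegnerHypothesis N K → ((Ideal.span {(p : ℤ)}).primesOver (𝓞 K)).ncard = 2 →
    IsOrdinaryAt W p → κ.IsAnticyclotomic →
    antiRestrict (twoVariablePAdicLFunctionK ι W κ hf) = 0

/-- **On the cyclotomic line the two-variable function is the product of the two one-variable
`p`-adic `L`-functions, up to a unit** (named fact; the "consistency" of the request). Printed:
Nekovář 1995, (5.13.4) (p. 636), with the specialisations of (6.1) (`c₁ = 1`, `γ₃ = 0`,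
`N₃' = N`, `r = 1`): "`L_p(f ⊗ K, λ ∘ N) = (D/c₁) λ(N₃')² (-1)^{r-1} t_p(f) |D|^{1/2}
L_p^{MTT}(f ⊗ K, x^{r-1}λ) / ((2c₁)^{2r-1} p^{γ₃(r-1)} (2π)² ⟨f,f⟩_N)` for any continuous
character `λ : G(ℚ_∞/ℚ) → 1 + pℤ_p", where "`L_p^{MTT}(f ⊗ K, λ) = L_p^{MTT}(f, λ)
L_p^{MTT}(f ⊗ (D/·), λ)`" in the normalisation of Mazur–Tate–Teitelbaum and
"`α_p(f ⊗ (D/·)) = (D/p) α_p(f)`" (p. 635); Perrin-Riou 1987, (1.1) for the same factorisation. The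
tree's `padicLFunction f α` is the Mazur–Tate–Teitelbaum function of `f` normalised by the period
`Ω⁺_f` (`IsPAdicLFunctionOf`), in the same variable `S = λ(γ₀) - 1`, `γ₀ = 1 + p`, and
`padicLFunctionEK W p K hf hg = L_p(f, α, S) · L_p(g, (D/p)α, S)` with `g` the newform of the
twist `E^{(D)}` (`= f ⊗ (D/·)`); the character `λ ↦ λ(N)²` is the unit `(1+S)^a`,
`a = 2 log_p N / log_p γ₀ ∈ ℤ_p`, of `ℤ_p⟦S⟧`. Recorded in the constant-free form implied by the
printed one: under the hypotheses of `existsUnique_isTwoVariablePAdicLFunctionK` there are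
`C ∈ ℚ_p^×` and `a ∈ ℤ_p` with
`cycRestrict (twoVariablePAdicLFunctionK …) = C · (1+S)^a · padicLFunctionEK W p K hf hg`
(`(1+S)^a = PowerSeries.binomialSeries ℚ_[p] a`). The explicit constant (`t_p(f)`, `|D|^{1/2}`,
periods) is deliberately not transcribed. [cite: Nekovar1995, (5.13.4) p. 636]
[cite: PerrinRiou1987, §1.1 (1.1)] -/
def cycRestrict_twoVariablePAdicLFunctionK_eq : Prop :=
  ∀ {p : ℕ} [Fact p.Prime] (ι : integralClosure ℚ ℂ →+* ℂ_[p]) (W : WeierstrassCurve ℚ)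
    [W.IsElliptic] [W.IsGloballyMinimal] (K : Type) [Field K] [NumberField K]
    (κ : ZpExtension K p) {N N' : ℕ} [NeZero N] [NeZero N'] {f : CuspForm (Gamma0 N) 2}
    {g : CuspForm (Gamma0 N') 2} (hf : IsNewformOf W f)
    (hg : IsNewformOf (W.quadraticTwist (NumberField.discr K : ℚ)) g),
    p ≠ 2 → ¬ p ∣ N → IsImaginaryQuadratic K → Odd (NumberField.discr K) →
    SatisfiesHeegnerHypothesis N K → ((Ideal.span {(p : ℤ)}).primesOver (𝓞 K)).ncard = 2 →
    IsOrdinaryAt W p → κ.IsAnticyclotomic →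
    ∃ (C : ℚ_[p]) (a : ℤ_[p]), C ≠ 0 ∧
      cycRestrict (twoVariablePAdicLFunctionK ι W κ hf) =
        PowerSeries.C C * PowerSeries.binomialSeries ℚ_[p] a * padicLFunctionEK W p K hf hg

/-- Consequence of the anticyclotomic vanishing: the cyclotomic restriction has zero constant
term (`L_p(E/K)` vanishes at the trivial character, the sign being `-1` under the Heegner
hypothesis; cf. `perrinRiou_padicGrossZagier`). [cite: Nekovar1995, Cor. of Prop. 5.12 (p. 635)] -/
theorem constantCoeff_cycRestrict_twoVariablePAdicLFunctionK
    (h : antiRestrict_twoVariablePAdicLFunctionK_eq_zero) {p : ℕ} [Fact p.Prime]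
    (ι : integralClosure ℚ ℂ →+* ℂ_[p]) (W : WeierstrassCurve ℚ) [W.IsElliptic]
    [W.IsGloballyMinimal] (K : Type) [Field K] [NumberField K] (κ : ZpExtension K p) {N : ℕ}
    [NeZero N] {f : CuspForm (Gamma0 N) 2} (hf : IsNewformOf W f) (hp : p ≠ 2) (hpN : ¬ p ∣ N)
    (hK : IsImaginaryQuadratic K) (hodd : Odd (NumberField.discr K))
    (hH : SatisfiesHeegnerHypothesis N K) (hsplit : ((Ideal.span {(p : ℤ)}).primesOver (𝓞 K)).ncard = 2)
    (hord : IsOrdinaryAt W p) (hκ : κ.IsAnticyclotomic) :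
    PowerSeries.constantCoeff (cycRestrict (twoVariablePAdicLFunctionK ι W κ hf)) = 0 :=
  constantCoeff_cycRestrict_eq_zero (h ι W K κ hf hp hpN hK hodd hH hsplit hord hκ)

/-- Consequence of the anticyclotomic vanishing for the linear term: since `ℒ_0 = 0`, the series
is `S · (ℒ_1 + S · (…))`, so the cyclotomic restriction has linear coefficient `[T⁰] ℒ_1 =
linearTermCoeff 0` (proved in general as `coeff_one_cycRestrict`) — the one-variable `p`-adic
Gross–Zagier quantity — while the route's `c(K)` is `linearTermCoeff 2`. [folklore] -/
theorem coeff_one_cycRestrict_twoVariablePAdicLFunctionK {p : ℕ} [Fact p.Prime]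
    (ι : integralClosure ℚ ℂ →+* ℂ_[p]) (W : WeierstrassCurve ℚ) [W.IsGloballyMinimal]
    (K : Type) [Field K] [NumberField K] (κ : ZpExtension K p) {N : ℕ} [NeZero N]
    {f : CuspForm (Gamma0 N) 2} (hf : IsNewformOf W f) :
    PowerSeries.coeff 1 (cycRestrict (twoVariablePAdicLFunctionK ι W κ hf)) =
      linearTermCoeff 0 (L := twoVariablePAdicLFunctionK ι W κ hf) :=
  coeff_one_cycRestrict _

end Interpolation

end Literature.NumberTheory.EllipticCurves

end
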